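import Summits.Ventures.PercRepro.RankLevelSetRuleQModelCount
import Summits.Ventures.PercRepro.RankLevelSetBiIndepPerElem

/-! # RankLevelSetBiIndepPerElemModel — THE PER-ELEMENT PROFILE INEQUALITY (★★) HOLDS ON THE WHOLE MODEL FAMILY
(night-1 g24; dossier §36.8 e)

`modelMatroid hE F q p = T_p(U_{q,F} ⊕ free)` is the cell's model family (gen 14): `X` is independent iff `X ⊆ E`,
`#(X ∩ F) ≤ q` and `#X ≤ p`. A set is bi-independent iff it and its complement satisfy this, i.e. (for `#X = r`)
`#F − q ≤ #(X ∩ F) ≤ q` and `#E − p ≤ r ≤ p`. THEOREM (`modelMatroid_biIndepPerElem`): for EVERY `E, F ⊆ E, q, p`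
the model satisfies `BiIndepPerElem`: for every `y ∈ E` and `2j + 1 < #E`,
`#{Z ∈ D_j : y ∉ Z} ≤ #{Q ∈ D_{j+1} : y ∈ Q}`.

PROOF. `y ∉ F` (a free element): `Z ↦ Z ∪ {y}` is an injection (the trace in `F` is unchanged). `y ∈ F`: split the
members avoiding `y` by their trace `t = #(Z ∩ F)`: those with `t < q` go to `Z ∪ {y}` (trace `t + 1 ≤ q`); those
with the FULL trace `t = q` are at most `C(#F−1, q)·C(#E−#F, j−q)` many (`ncard_subsets_inter_eq`), while the
bi-independent `(j+1)`-sets through `y` of MINIMAL trace `m = #F − q` (never hit by the first map, whose images have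
trace `≥ m + 1`) are at least `C(#F−1, m−1)·C(#E−#F, j+1−m)` many; `C(#F−1, q) = C(#F−1, m−1)` by symmetry and
`C(N, j−q) ≤ C(N, j+1−m)` by the unimodality of the binomial coefficients, because `j − q ≤ j + 1 − m ≤ N − (j − q)`
is exactly `2j + 1 ≤ #E` (`N = #E − #F`). Hence, with `RankLevelSetBiIndepPerElem`, the monotone form of the profile
and the global level-wise form (the `𝒜 = 𝒵` case of `LevelHallUpC025` at every level, and of `HallUpC025`, at the
tight layer) hold on the model family UNCONDITIONALLY (`modelMatroid_biIndepMono`). Axioms: standard. -/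

namespace PercRepro

open Set Matroid

variable {α : Type}

/-! ## Binomial unimodality -/

/-- `C(N, a) ≤ C(N, b)` for `a ≤ b ≤ N / 2` (the binomial coefficients increase up to the middle). -/
lemma choose_mono_below_half {N a b : ℕ} (hab : a ≤ b) (hb : b ≤ N / 2) : N.choose a ≤ N.choose b := by
  induction b, hab using Nat.le_induction with
  | base => exact le_rfl
  | succ b hab ih =>
    exact (ih (by omega)).trans (Nat.choose_le_succ_of_lt_half_left (by omega))

/-- **Binomial unimodality**: `C(N, a) ≤ C(N, b)` whenever `a ≤ b ≤ N − a` (`b` is at least as close to the middle). -/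
lemma choose_le_choose_of_le_of_le_sub {N a b : ℕ} (hab : a ≤ b) (hb : b ≤ N - a) : N.choose a ≤ N.choose b := by
  by_cases hb2 : b ≤ N / 2
  · exact choose_mono_below_half hab hb2
  · have hbN : b ≤ N := by omega
    rw [← Nat.choose_symm hbN]
    exact choose_mono_below_half (by omega) (by omega)

/-! ## Bi-independent sets of the model -/

/-- **Bi-independence in the model, unfolded**: `S ⊆ E`, `#S = r`, `#(S ∩ F) ≤ q`, `#S ≤ p`, `#((E ∖ S) ∩ F) ≤ q`,
`#(E ∖ S) ≤ p`. -/
lemma model_mem_biIndep_iff {E : Set α} (hE : E.Finite) (F : Set α) (q p r : ℕ) (S : Set α) :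
    S ∈ biIndep (modelMatroid hE F q p) r ↔
      S ⊆ E ∧ S.ncard = r ∧ (S ∩ F).ncard ≤ q ∧ S.ncard ≤ p ∧ ((E \ S) ∩ F).ncard ≤ q ∧ (E \ S).ncard ≤ p := by
  constructor
  · rintro ⟨hSE, hr, ⟨-, h1, h2⟩, ⟨-, h3, h4⟩⟩
    exact ⟨hSE, hr, h1, h2, h3, h4⟩
  · rintro ⟨hSE, hr, h1, h2, h3, h4⟩
    exact ⟨hSE, hr, ⟨hSE, h1, h2⟩, ⟨Set.sdiff_subset, h3, h4⟩⟩

/-- The traces of a set and of its complement add up to `#F` (`F ⊆ E`, `E` finite). -/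
lemma trace_add_trace_compl {E F S : Set α} (hE : E.Finite) (hF : F ⊆ E) :
    (S ∩ F).ncard + ((E \ S) ∩ F).ncard = F.ncard := by
  have h1 : (E \ S) ∩ F = F \ S := by
    ext x; simp only [Set.mem_inter_iff, Set.mem_sdiff]
    exact ⟨fun h => ⟨h.2, h.1.2⟩, fun h => ⟨⟨hF h.1, h.2⟩, h.1⟩⟩
  rw [h1, Set.inter_comm]
  exact Set.ncard_inter_add_ncard_sdiff_eq_ncard F S (hE.subset hF)

/-! ## The theorem -/

/-- **(★★) ON THE MODEL FAMILY**: for every finite `E`, `F ⊆ E` and `q, p`, `modelMatroid hE F q p` satisfies the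
per-element profile inequality `BiIndepPerElem`. -/
theorem modelMatroid_biIndepPerElem {E : Set α} (hE : E.Finite) {F : Set α} (hF : F ⊆ E) (q p : ℕ) :
    BiIndepPerElem (modelMatroid hE F q p) := by
  classical
  haveI : (modelMatroid hE F q p).Finite := modelMatroid_finite hE F q p
  intro y hy j hj
  set M := modelMatroid hE F q p with hM
  have hME : M.E = E := rfl
  rw [hME] at hy hj
  -- the two families
  set 𝒜 : Set (Set α) := {Z ∈ biIndep M j | y ∉ Z} with h𝒜
  set ℬ : Set (Set α) := {Q ∈ biIndep M (j + 1) | y ∈ Q} with hℬ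
  have hℬfin : ℬ.Finite := (biIndep_finite M (j + 1)).subset (fun Q hQ => hQ.1)
  have h𝒜fin : 𝒜.Finite := (biIndep_finite M j).subset (fun Z hZ => hZ.1)
  -- size facts from a member avoiding `y`
  have hsize : ∀ Z ∈ 𝒜, j + 1 ≤ p ∧ E.ncard ≤ p + j := by
    intro Z hZ
    obtain ⟨hZbi, hyZ⟩ := hZ
    rw [model_mem_biIndep_iff] at hZbi
    obtain ⟨hZE, hZcard, -, -, -, hcompl⟩ := hZbi
    have hEsplit : E.ncard = Z.ncard + (E \ Z).ncard := by
      rw [Set.ncard_sdiff' hZE hE]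
      have := Set.ncard_le_ncard hZE hE
      omega
    constructor <;> omega
  -- the first map: `Z ↦ insert y Z` on the members whose trace stays below `q` (all of them when `y ∉ F`)
  have hins_mem : ∀ Z ∈ 𝒜, (Z ∩ F).ncard + (if y ∈ F then 1 else 0) ≤ q →
      insert y Z ∈ ℬ ∧ ((insert y Z) ∩ F).ncard = (Z ∩ F).ncard + (if y ∈ F then 1 else 0) := by
    intro Z hZ htr
    obtain ⟨hjp, hEp⟩ := hsize Z hZ
    obtain ⟨hZbi, hyZ⟩ := hZ
    rw [model_mem_biIndep_iff] at hZbi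
    obtain ⟨hZE, hZcard, hZtr, hZp, hZctr, hZcp⟩ := hZbi
    have hZfin : Z.Finite := hE.subset hZE
    have htrace : ((insert y Z) ∩ F).ncard = (Z ∩ F).ncard + (if y ∈ F then 1 else 0) := by
      by_cases hyF : y ∈ F
      · simp only [hyF, if_true]
        rw [Set.insert_inter_of_mem hyF, Set.ncard_insert_of_notMem (fun h => hyZ h.1) (hZfin.inter_of_left F)]
      · simp only [hyF, if_false, add_zero]
        rw [Set.insert_inter_of_notMem hyF]
    refine ⟨?_, htrace⟩
    refine ⟨?_, Set.mem_insert y Z⟩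
    rw [model_mem_biIndep_iff]
    have hcard : (insert y Z).ncard = j + 1 := by
      rw [Set.ncard_insert_of_notMem hyZ hZfin, hZcard]
    have hsub : E \ insert y Z ⊆ E \ Z := Set.sdiff_subset_sdiff_right (Set.subset_insert y Z)
    refine ⟨Set.insert_subset hy hZE, hcard, ?_, ?_, ?_, ?_⟩
    · rw [htrace]; exact htr
    · rw [hcard]; exact hjp
    · exact (Set.ncard_le_ncard (Set.inter_subset_inter_left F hsub)
        ((hE.subset Set.sdiff_subset).inter_of_left F)).trans hZctr
    · exact (Set.ncard_le_ncard hsub (hE.subset Set.sdiff_subset)).trans hZcp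
  have hins_inj : Set.InjOn (fun Z => insert y Z) 𝒜 := by
    intro Z hZ Z' hZ' hgg
    simp only at hgg
    ext x
    constructor
    · intro hx
      have h1 : x ∈ insert y Z' := by rw [← hgg]; exact Set.mem_insert_of_mem y hx
      rcases Set.mem_insert_iff.mp h1 with hxy | hx'
      · exact absurd (hxy ▸ hx) hZ.2
      · exact hx'
    · intro hx
      have h1 : x ∈ insert y Z := by rw [hgg]; exact Set.mem_insert_of_mem y hx
      rcases Set.mem_insert_iff.mp h1 with hxy | hx'
      · exact absurd (hxy ▸ hx) hZ'.2
      · exact hx'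
  by_cases hyF : y ∈ F
  · -- `y ∈ F`: split by the trace
    set 𝒜₁ : Set (Set α) := {Z ∈ 𝒜 | (Z ∩ F).ncard + 1 ≤ q} with h𝒜₁
    set 𝒜₂ : Set (Set α) := {Z ∈ 𝒜 | (Z ∩ F).ncard = q} with h𝒜₂
    have hsplit : 𝒜 = 𝒜₁ ∪ 𝒜₂ := by
      ext Z
      simp only [h𝒜₁, h𝒜₂, Set.mem_union, Set.mem_setOf_eq]
      constructor
      · intro hZ
        have htr : (Z ∩ F).ncard ≤ q := by
          have := hZ.1; rw [model_mem_biIndep_iff] at this; exact this.2.2.1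
        rcases Nat.lt_or_ge (Z ∩ F).ncard q with h | h
        · exact Or.inl ⟨hZ, h⟩
        · exact Or.inr ⟨hZ, le_antisymm htr h⟩
      · rintro (⟨hZ, -⟩ | ⟨hZ, -⟩) <;> exact hZ
    have hdisj : Disjoint 𝒜₁ 𝒜₂ := by
      rw [Set.disjoint_left]
      rintro Z ⟨-, h1⟩ ⟨-, h2⟩
      omega
    have h𝒜₁fin : 𝒜₁.Finite := h𝒜fin.subset (fun Z hZ => hZ.1)
    have h𝒜₂fin : 𝒜₂.Finite := h𝒜fin.subset (fun Z hZ => hZ.1)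
    -- the images
    set ℬ₁ : Set (Set α) := (fun Z => insert y Z) '' 𝒜₁ with hℬ₁
    set m : ℕ := F.ncard - q with hm
    set ℬ₂ : Set (Set α) := {Q ∈ ℬ | (Q ∩ F).ncard = m} with hℬ₂
    have hℬ₁sub : ℬ₁ ⊆ ℬ := by
      rintro Q ⟨Z, hZ, rfl⟩
      exact (hins_mem Z hZ.1 (by simp only [hyF, if_true]; exact hZ.2)).1
    have hℬ₁card : ℬ₁.ncard = 𝒜₁.ncard :=
      Set.InjOn.ncard_image (hins_inj.mono (fun Z hZ => hZ.1))
    have hℬ₁tr : ∀ Q ∈ ℬ₁, m + 1 ≤ (Q ∩ F).ncard := by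
      rintro Q ⟨Z, hZ, rfl⟩
      have h := (hins_mem Z hZ.1 (by simp only [hyF, if_true]; exact hZ.2)).2
      simp only [hyF, if_true] at h
      rw [h]
      have hZbi := hZ.1.1
      rw [model_mem_biIndep_iff] at hZbi
      have htot := trace_add_trace_compl (S := Z) hE hF
      have := hZbi.2.2.2.2.1
      omega
    have hdisjB : Disjoint ℬ₁ ℬ₂ := by
      rw [Set.disjoint_left]
      intro Q hQ1 hQ2
      have := hℬ₁tr Q hQ1
      have := hQ2.2
      omega
    have hℬ₂sub : ℬ₂ ⊆ ℬ := fun Q hQ => hQ.1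
    -- counting the full-trace members and the minimal-trace targets
    have hcount : 𝒜₂.ncard ≤ ℬ₂.ncard := by
      by_cases hne : 𝒜₂ = ∅
      · rw [hne, Set.ncard_empty]; exact Nat.zero_le _
      obtain ⟨Z₀, hZ₀⟩ := Set.nonempty_iff_ne_empty.mpr hne
      obtain ⟨hjp, hEp⟩ := hsize Z₀ hZ₀.1
      have hZ₀bi := hZ₀.1.1
      rw [model_mem_biIndep_iff] at hZ₀bi
      obtain ⟨hZ₀E, hZ₀card, -, -, hZ₀ctr, -⟩ := hZ₀bi
      have hZ₀tr : (Z₀ ∩ F).ncard = q := hZ₀.2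
      have htot₀ := trace_add_trace_compl (S := Z₀) hE hF
      -- `#F ≤ 2q`, `q ≤ j`, `q + 1 ≤ #F`
      have hF2q : F.ncard ≤ 2 * q := by omega
      have hqj : q ≤ j := by
        rw [← hZ₀tr, ← hZ₀card]
        exact Set.ncard_le_ncard Set.inter_subset_left (hE.subset hZ₀E)
      have hFq : q + 1 ≤ F.ncard := by
        have hyZ₀ : y ∉ Z₀ := hZ₀.1.2
        have : (insert y (Z₀ ∩ F)).ncard = (Z₀ ∩ F).ncard + 1 :=
          Set.ncard_insert_of_notMem (fun h => hyZ₀ h.1) ((hE.subset hZ₀E).inter_of_left F)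
        have hsub : insert y (Z₀ ∩ F) ⊆ F := Set.insert_subset hyF Set.inter_subset_right
        have := Set.ncard_le_ncard hsub (hE.subset hF)
        omega
      have hm1 : 1 ≤ m := by omega
      -- the finsets `E' = E ∖ {y}`, `F' = F ∖ {y}`
      set E' : Finset α := (hE.toFinset).erase y with hE'
      set F' : Finset α := ((hE.subset hF).toFinset).erase y with hF'
      have hF'E' : F' ⊆ E' := by
        intro x hx
        rw [hF', Finset.mem_erase] at hx
        rw [hE', Finset.mem_erase]
        exact ⟨hx.1, by rw [hE.mem_toFinset]; exact hF ((hE.subset hF).mem_toFinset.mp hx.2)⟩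
      have hE'card : E'.card = E.ncard - 1 := by
        rw [hE', Finset.card_erase_of_mem (hE.mem_toFinset.mpr hy), ← Set.ncard_eq_toFinset_card E hE]
      have hF'card : F'.card = F.ncard - 1 := by
        rw [hF', Finset.card_erase_of_mem ((hE.subset hF).mem_toFinset.mpr hyF),
          ← Set.ncard_eq_toFinset_card F (hE.subset hF)]
      have hE'coe : (E' : Set α) = E \ {y} := by
        rw [hE', Finset.coe_erase, hE.coe_toFinset]
      have hF'coe : (F' : Set α) = F \ {y} := by
        rw [hF', Finset.coe_erase, (hE.subset hF).coe_toFinset]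
      have hEF : E'.card - F'.card = E.ncard - F.ncard := by
        have := Set.ncard_le_ncard hF hE
        omega
      -- the full-trace members inject into the `j`-subsets of `E'` of trace `q` in `F'`
      have hA2 : 𝒜₂.ncard ≤ F'.card.choose q * (E'.card - F'.card).choose (j - q) := by
        rw [← ncard_subsets_inter_eq E' F' hF'E' j q hqj]
        refine Set.ncard_le_ncard ?_ ?_
        · intro Z hZ
          have hZbi := hZ.1.1
          rw [model_mem_biIndep_iff] at hZbi
          have hyZ : y ∉ Z := hZ.1.2
          refine ⟨?_, hZbi.2.1, ?_⟩
          · rw [hE'coe]; exact fun x hx => ⟨hZbi.1 hx, fun h => hyZ (h ▸ hx)⟩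
          · rw [hF'coe, ← hZ.2]
            congr 1
            ext x
            simp only [Set.mem_inter_iff, Set.mem_sdiff, Set.mem_singleton_iff]
            exact ⟨fun h => ⟨h.1, h.2.1⟩, fun h => ⟨h.1, h.2, fun hxy => hyZ (hxy ▸ h.1)⟩⟩
        · exact hE.finite_subsets.subset (fun X hX => hX.1.trans (by rw [hE'coe]; exact Set.sdiff_subset))
      -- the minimal-trace targets contain the image of the `j`-subsets of `E'` of trace `m − 1`
      have hB2 : F'.card.choose (m - 1) * (E'.card - F'.card).choose (j - (m - 1)) ≤ ℬ₂.ncard := by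
        rw [← ncard_subsets_inter_eq E' F' hF'E' j (m - 1) (by omega)]
        refine Set.ncard_le_ncard_of_injOn (fun X => insert y X) ?_ ?_ (hℬfin.subset hℬ₂sub)
        · rintro X ⟨hXE', hXcard, hXtr⟩
          rw [hE'coe] at hXE'
          rw [hF'coe] at hXtr
          have hyX : y ∉ X := fun h => (hXE' h).2 rfl
          have hXE : X ⊆ E := fun x hx => (hXE' hx).1
          have hXfin : X.Finite := hE.subset hXE
          have hXtr' : (X ∩ F).ncard = m - 1 := by
            rw [← hXtr]; congr 1; ext x
            simp only [Set.mem_inter_iff, Set.mem_sdiff, Set.mem_singleton_iff]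
            exact ⟨fun h => ⟨h.1, h.2, fun hxy => hyX (hxy ▸ h.1)⟩, fun h => ⟨h.1, h.2.1⟩⟩
          have hQtr : ((insert y X) ∩ F).ncard = m := by
            rw [Set.insert_inter_of_mem hyF, Set.ncard_insert_of_notMem (fun h => hyX h.1) (hXfin.inter_of_left F),
              hXtr']
            omega
          have hQcard : (insert y X).ncard = j + 1 := by
            rw [Set.ncard_insert_of_notMem hyX hXfin, hXcard]
          have hQE : insert y X ⊆ E := Set.insert_subset hy hXE
          refine ⟨⟨?_, Set.mem_insert y X⟩, hQtr⟩
          rw [model_mem_biIndep_iff]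
          have htot := trace_add_trace_compl (S := insert y X) hE hF
          refine ⟨hQE, hQcard, by rw [hQtr]; omega, by rw [hQcard]; exact hjp, by omega, ?_⟩
          rw [Set.ncard_sdiff' hQE hE, hQcard]
          omega
        · intro X hX X' hX' hXX'
          simp only at hXX'
          have hyX : y ∉ X := by rw [hE'coe] at hX; exact fun h => (hX.1 h).2 rfl
          have hyX' : y ∉ X' := by rw [hE'coe] at hX'; exact fun h => (hX'.1 h).2 rfl
          ext x
          constructor
          · intro hx
            have h1 : x ∈ insert y X' := by rw [← hXX']; exact Set.mem_insert_of_mem y hx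
            rcases Set.mem_insert_iff.mp h1 with hxy | hx'
            · exact absurd (hxy ▸ hx) hyX
            · exact hx'
          · intro hx
            have h1 : x ∈ insert y X := by rw [hXX']; exact Set.mem_insert_of_mem y hx
            rcases Set.mem_insert_iff.mp h1 with hxy | hx'
            · exact absurd (hxy ▸ hx) hyX'
            · exact hx'
      -- the binomial inequality
      have hbin : F'.card.choose q * (E'.card - F'.card).choose (j - q) ≤
          F'.card.choose (m - 1) * (E'.card - F'.card).choose (j - (m - 1)) := by
        have hsym : F'.card.choose q = F'.card.choose (m - 1) := by
          have h1 : F'.card - q = m - 1 := by omega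
          rw [← h1, Nat.choose_symm (by omega)]
        rw [hsym]
        refine Nat.mul_le_mul_left _ (choose_le_choose_of_le_of_le_sub (by omega) ?_)
        rw [hEF]
        have := Set.ncard_le_ncard hF hE
        omega
      exact hA2.trans (hbin.trans hB2)
    -- assemble
    have hunion : ℬ₁ ∪ ℬ₂ ⊆ ℬ := Set.union_subset hℬ₁sub hℬ₂sub
    calc 𝒜.ncard = (𝒜₁ ∪ 𝒜₂).ncard := by rw [hsplit]
      _ = 𝒜₁.ncard + 𝒜₂.ncard := Set.ncard_union_eq hdisj h𝒜₁fin h𝒜₂fin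
      _ ≤ ℬ₁.ncard + ℬ₂.ncard := by rw [hℬ₁card]; exact Nat.add_le_add_left hcount _
      _ = (ℬ₁ ∪ ℬ₂).ncard := (Set.ncard_union_eq hdisjB (hℬfin.subset hℬ₁sub) (hℬfin.subset hℬ₂sub)).symm
      _ ≤ ℬ.ncard := Set.ncard_le_ncard hunion hℬfin
  · -- `y ∉ F`: the insertion map is an injection of the whole family
    refine Set.ncard_le_ncard_of_injOn (fun Z => insert y Z) ?_ hins_inj hℬfin
    intro Z hZ
    have hZbi := hZ.1
    rw [model_mem_biIndep_iff] at hZbi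
    exact (hins_mem Z hZ (by simp only [hyF, if_false, add_zero]; exact hZbi.2.2.1)).1

/-- **The monotone form of the profile on the model family**, unconditionally. -/
theorem modelMatroid_biIndepMono {E : Set α} (hE : E.Finite) {F : Set α} (hF : F ⊆ E) (q p : ℕ) :
    haveI := modelMatroid_finite hE F q p
    BiIndepMono (modelMatroid hE F q p) :=
  haveI := modelMatroid_finite hE F q p
  biIndepMono_of_perElem _ (modelMatroid_biIndepPerElem hE hF q p)

/-- **The global level-wise form on the model family, UNCONDITIONALLY** (tight layer `#E = p + q`, rank `p`,
`q < t < p`): `C(p+q,t)·#𝒵 ≤ C(p+q,q)·#{S ∈ upNbhd 𝒵 : r(S) = t}` — the `𝒜 = 𝒵` case of `LevelHallUpC025` on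
`modelMatroid hE F q p`, no Lorentzian input. -/
theorem modelMatroid_levelHallUp_members {E : Set α} (hE : E.Finite) {F : Set α} (hF : F ⊆ E) {q p t : ℕ}
    (hn : E.ncard = p + q) (hrk : (modelMatroid hE F q p).eRank = (p : ℕ∞)) (hqt : q < t) (htp : t < p) :
    haveI := modelMatroid_finite hE F q p
    ((p + q).choose t : ℚ) * ((cellMembers (modelMatroid hE F q p) p q).ncard : ℚ) ≤
      ((p + q).choose q : ℚ) *
        ({S ∈ upNbhd (modelMatroid hE F q p) p q (cellMembers (modelMatroid hE F q p) p q) |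
          (modelMatroid hE F q p).eRk S = (t : ℕ∞)}.ncard : ℚ) :=
  haveI := modelMatroid_finite hE F q p
  levelHallUp_members_rank_of_biIndepMono _ (modelMatroid_biIndepMono hE hF q p) hn hrk hqt htp

/-- **The `𝒜 = 𝒵` case of C-044 UP at the tight layer of the model family, UNCONDITIONALLY**:
`phiK p q · #𝒵 ≤ #upNbhd 𝒵` on `modelMatroid hE F q p` with `#E = p + q` and rank `p`. -/
theorem modelMatroid_hallUp_members {E : Set α} (hE : E.Finite) {F : Set α} (hF : F ⊆ E) {q p : ℕ}
    (hn : E.ncard = p + q) (hrk : (modelMatroid hE F q p).eRank = (p : ℕ∞)) :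
    haveI := modelMatroid_finite hE F q p
    phiK p q * ((cellMembers (modelMatroid hE F q p) p q).ncard : ℚ) ≤
      ((upNbhd (modelMatroid hE F q p) p q (cellMembers (modelMatroid hE F q p) p q)).ncard : ℚ) :=
  haveI := modelMatroid_finite hE F q p
  hallUp_members_of_biIndepMono _ (modelMatroid_biIndepMono hE hF q p) hn hrk

end PercRepro
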